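/-
Copyright (c) 2026 the pub-hodgecm-mathlib formalisation cell (harness21).  Prover seat hodgecm-mathlib-LH4-p09 (g2), req620 Track A «(D-RAM) FOUR-FRAME» squad
(heir LEAD F0P3a-plan lineage; dealer LH4-plan lineage WORD #14; MS ROAD A, Stage B brick B5₂ (i) — the TYPE-2 twin of ★ p855737 `F0P3cDyRamDiagonalGluedTubeCriterion`).  2026-09-04.
-/
import Summits.HodgeConjecture.HodgeConjecture.Theorems.F0P3cDyRamDiagonalGluedTubeCriterion  -- ★ p855737: `formCongr_hnf_diagonal`, `det_coe_hnf`, `det_formCongr_diagonal`, `single_two_mem_latt_hnf_iff`, `isIntMatrix_of_fin_three`; brings ★ `isVertexLattice_latt_iff_of_v`, `latt_hnf_le_stdLattice`, `scaleLattice_dualLatt_le_of_isVertexLattice`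
import Summits.HodgeConjecture.HodgeConjecture.Theorems.F0P3cDyRamDiagonalStrataDefs         -- ★ p855793 ED. 2: `IsTypeTwoPolarisable`
import Literature.NumberTheory.Automorphic.UnitaryThreeLevelTwoCongruence                     -- ★ `v_sub_le_of_le`, `v_mul_le_of_le_one_of_le`, `v_mul_le_of_le_of_le_one`
import HarnessLib

/-!
# Crux `H413`, MS ROAD A, STAGE B brick B5₂ (i): «GLUED TUBE STRATA, TYPE 2 — THE POLARISABILITY CRITERION (R)»

Cell `hodgecm-mathlib` (D-0151), FLOOR 0, crux item H413 = `stmt-HodgeConjecture-24833`; lane `--supports stmt-HodgeConjecture-24833 --as helper` (count-neutral).  THEOREMS ONLY.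
LH4-p10 (g2) MEMO v2.1 §T2.3 (`F0/P3c/LH4/LH4-p10/g2/MEMO-stableLaw-finite.v2.1-type2.LH4p10g2.md`) and LH4-p04 (g2) CENSUS-B3type2 §1: in the TYPE-2 stable count `N₂ = [k]_q` the lattices of
the glued stratum `G₁(2ρ+1, s)` (`s` even) are `M = latt V`, `V = (1 0 0; x ϖ^ρ 0; xζ + y″ ϖ^ρζ ϖ^{2ρ+1+s})` with units `x, ζ` and `|y″| = |ϖ|^s` — the type-0 glued frame of
★ p855737 with the LAST EXPONENT ONE LARGER.  THIS FILE: such an `M` is TYPE-2 POLARISABLE (a type-2 vertex lattice for SOME `σ`-fixed non-degenerate diagonal form `diag D`,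
★ `IsTypeTwoPolarisable` of the Stage B defs leaf `F0P3cDyRamDiagonalStrataDefs` ED. 2) **iff (R): `ζ·σ(y″)∕σ(x)` is congruent to a `σ`-fixed element modulo `𝔭^{ρ+s}`** — the SAME
letters as the type-0 criterion of ★ p855737 at `2t = s`.  With `G = (σV)ᵀ·diag D·V`, type 2 means: `G` integral, `ϖ·G⁻¹` integral, `|det G| = |ϖ|²` (★ `isVertexLattice_latt_iff_of_v`).
* `isIntMatrix_smul_inv_fin_three` — §1: a `3 × 3` matrix with `|det| = |ϖ|²`, integral upper-left `2 × 2` block of RANK ONE (`g₀₀g₁₁ = g₀₁g₁₀`) and all other entries in `𝔭`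
  has `ϖ·G⁻¹` integral (the nine cofactors lie in `𝔭`; `Matrix.adjugate_fin_three`).
* `exists_fixed_of_isTypeTwoPolarisable_latt_hnf_glued` — §2: polarisable ⟹ (R): `ϖ·D₂⁻¹e₃ ∈ ϖM^♯ ⊆ M` pins `|D₂|⁻¹ ≤ |ϖ|^{2ρ+s}`, then the Gram entry `G₀₁ = ϖ^ρ·D₂·(ζσy″ − σx·f)`
  with the FIXED `f = −(D₁ + D₂Nζ)∕D₂` is integral — which is (R).
* `isVertexLattice_two_latt_hnf_glued_explicit` ∕ `isTypeTwoPolarisable_latt_hnf_glued_of` — §3: (R) ⟹ polarisable, by the explicit fixed form `D = (N(A)∕E − NxD₁ − NyD₂, −P(Nζ + f), P)`, `P = π₀^{−(ρ+s∕2)}`, `π₀ = ϖσϖ`,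
  `E = D₁ + NζD₂ = −Pf`, `A = P(ζσy″ − σx·f)`: then `G₀₁ = ϖ^ρA`, `G₁₀ = σ(ϖ^ρ)σA`, `G₁₁ = N(ϖ^ρ)E` (a unit), `G₀₀ = N(A)∕E` so that `G₀₀G₁₁ = G₀₁G₁₀` EXACTLY; `|D₀| = |ϖ|^{−2ρ}`
  by the wild trace bound, whence `|det G| = |ϖ|²`.
* **`isTypeTwoPolarisable_latt_hnf_glued_iff`** — §4: the criterion (`ρ ≥ 1`, `s` even `≥ 2`).
* The `ρ = 0` stratum `G₁(1, s)` (frame `(1 0 0; 0 1 0; y″ ζ ϖ^{1+s})`) is polarisable UNCONDITIONALLY — companion file `F0P3cDyRamDiagonalGluedTubeCriterionTypeTwoZero`.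
HONEST LABEL.  Count-neutral; the census laws stay PROVER TARGETS until the MS assembly lands; `HC_CM` is proved only modulo the 7 printed citations (2 remaining named inputs:
hLiu418 = `stmt-HodgeConjecture-24832`, h413 = `stmt-HodgeConjecture-24833`) until rung 0 closes.

## References
* [Jacobowitz1962] R. Jacobowitz, *Hermitian forms over local fields*, Amer. J. Math. 84 (1962), §4, §7 (Gram matrices, modular lattices, dual bases).
* [Kottwitz1986BaseChangeUnits] R. Kottwitz, *Base change for unit elements of Hecke algebras*, Compositio Math. 60 (1986), §1 pp. 240–241 (fixed-lattice counting).
* [Serre1980Trees] J.-P. Serre, *Trees*, Springer (1980), Ch. II §1.1 (lattices `g·𝒪^N`, Hermite normal form).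
-/

set_option autoImplicit false

noncomputable section

namespace Summit.HodgeConjecture.HodgeConjecture.Cruxes.H413.F0P3cDyRamDiagonalGluedTubeCriterionTypeTwo

open Matrix
open Literature.NumberTheory.Automorphic Literature.NumberTheory.Automorphic.HermitianLattice Literature.NumberTheory.Automorphic.UnitaryGroup
open Literature.NumberTheory.Automorphic.UnitaryLatticeTree
open Summit.HodgeConjecture.HodgeConjecture.Cruxes.H413.F0P3cDyRamDiagonalTorusDefs
open Summit.HodgeConjecture.HodgeConjecture.Cruxes.H413.F0P3cDyRamDiagonalStableLatticeHNF
open Summit.HodgeConjecture.HodgeConjecture.Cruxes.H413.F0P3cDyRamDiagonalGluedTubeCriterion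
open Summit.HodgeConjecture.HodgeConjecture.Cruxes.H413.F0P3cDyRamDiagonalStrataDefs
open scoped Valued WithZero Matrix MatrixGroups

variable {K : Type*} [Field K] [Valued K ℤᵐ⁰]

/-! ## §1  `ϖ·G⁻¹` is integral when the cofactors lie in `𝔭` -/

/-- `|−a + b| ≤ c` when `|a|, |b| ≤ c` (the shape of the off-diagonal cofactors of `Matrix.adjugate_fin_three`). [cite: Serre1980Trees, Ch. II §1.1] -/
theorem v_neg_add_le {a b : K} {c : ℤᵐ⁰} (ha : Valued.v a ≤ c) (hb : Valued.v b ≤ c) : Valued.v (-a + b) ≤ c := by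
  rw [neg_add_eq_sub]; exact v_sub_le_of_le hb ha

/-- **`ϖ·G⁻¹` IS INTEGRAL** for a `3 × 3` matrix `G` with `|det G| = |ϖ|²`, integral upper-left `2 × 2` block of rank one (`g₀₀g₁₁ = g₀₁g₁₀`) and all other entries in `𝔭 = ϖ𝒪`:
every cofactor lies in `𝔭` (eight of them contain a factor from `𝔭`, the ninth vanishes), and `ϖ·G⁻¹ = (ϖ∕det G)·adj G`. [cite: Jacobowitz1962, §7] -/
theorem isIntMatrix_smul_inv_fin_three {ϖ a b c d e f g h i : K} (hϖ0 : ϖ ≠ 0) (hϖ1 : Valued.v ϖ ≤ 1)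
    (hdet : Valued.v (!![a, b, c; d, e, f; g, h, i] : Matrix (Fin 3) (Fin 3) K).det = Valued.v ϖ ^ 2)
    (ha : Valued.v a ≤ 1) (hb : Valued.v b ≤ 1) (hd : Valued.v d ≤ 1) (he : Valued.v e ≤ 1)
    (hc : Valued.v c ≤ Valued.v ϖ) (hf : Valued.v f ≤ Valued.v ϖ) (hg : Valued.v g ≤ Valued.v ϖ) (hh : Valued.v h ≤ Valued.v ϖ) (hi : Valued.v i ≤ Valued.v ϖ)
    (hrk : a * e = b * d) :
    IsIntMatrix (ϖ • (!![a, b, c; d, e, f; g, h, i] : Matrix (Fin 3) (Fin 3) K)⁻¹) := by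
  set G : Matrix (Fin 3) (Fin 3) K := !![a, b, c; d, e, f; g, h, i] with hG
  have hvϖ : 0 < Valued.v ϖ := (Valuation.pos_iff _).2 hϖ0
  have hf1 : Valued.v f ≤ 1 := hf.trans hϖ1; have hg1 : Valued.v g ≤ 1 := hg.trans hϖ1; have hh1 : Valued.v h ≤ 1 := hh.trans hϖ1
  -- the nine cofactors lie in `𝔭`
  have hadj : ∀ j k, Valued.v (G.adjugate j k) ≤ Valued.v ϖ := by
    intro j k
    rw [hG, Matrix.adjugate_fin_three_of]
    fin_cases j <;> fin_cases k <;>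
      simp only [Matrix.of_apply, Matrix.cons_val', Matrix.cons_val_zero, Matrix.cons_val_one, Matrix.cons_val_two, Matrix.empty_val', Matrix.cons_val_fin_one,
        Matrix.tail_cons, Matrix.head_cons, Matrix.head_fin_const, Fin.isValue, Fin.mk_one, Fin.zero_eta, Fin.reduceFinMk]
    · exact v_sub_le_of_le (v_mul_le_of_le_one_of_le he hi) (v_mul_le_of_le_of_le_one hf hh1)
    · exact v_neg_add_le (v_mul_le_of_le_one_of_le hb hi) (v_mul_le_of_le_of_le_one hc hh1)
    · exact v_sub_le_of_le (v_mul_le_of_le_one_of_le hb hf) (v_mul_le_of_le_of_le_one hc he)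
    · exact v_neg_add_le (v_mul_le_of_le_one_of_le hd hi) (v_mul_le_of_le_of_le_one hf hg1)
    · exact v_sub_le_of_le (v_mul_le_of_le_one_of_le ha hi) (v_mul_le_of_le_of_le_one hc hg1)
    · exact v_neg_add_le (v_mul_le_of_le_one_of_le ha hf) (v_mul_le_of_le_of_le_one hc hd)
    · exact v_sub_le_of_le (v_mul_le_of_le_one_of_le hd hh) (v_mul_le_of_le_one_of_le he hg)
    · exact v_neg_add_le (v_mul_le_of_le_one_of_le ha hh) (v_mul_le_of_le_one_of_le hb hg)
    · rw [hrk, sub_self, map_zero]; exact zero_le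
  have hdet0 : G.det ≠ 0 := fun h0 => by
    rw [h0, map_zero] at hdet; exact pow_ne_zero 2 hvϖ.ne' hdet.symm
  intro j k
  rw [Matrix.smul_apply, Matrix.inv_def, Ring.inverse_eq_inv, Matrix.smul_apply, smul_eq_mul, smul_eq_mul, map_mul, map_mul, map_inv₀, hdet]
  calc Valued.v ϖ * ((Valued.v ϖ ^ 2)⁻¹ * Valued.v (G.adjugate j k)) ≤ Valued.v ϖ * ((Valued.v ϖ ^ 2)⁻¹ * Valued.v ϖ) :=
        mul_le_mul_right (mul_le_mul_right (hadj j k) _) _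
    _ = (Valued.v ϖ * (Valued.v ϖ)⁻¹) * ((Valued.v ϖ)⁻¹ * Valued.v ϖ) := by rw [sq, mul_inv]; ac_rfl
    _ = 1 := by rw [mul_inv_cancel₀ hvϖ.ne', inv_mul_cancel₀ hvϖ.ne', one_mul]

/-! ## §2  Polarisable ⟹ (R) -/

/-- **TYPE-2 POLARISABLE ⟹ (R)**: if `latt V` (type-2 glued frame, last exponent `2ρ+1+s`) is a type-2 vertex lattice for a `σ`-fixed non-degenerate diagonal form `diag D`,
then `ϖ·D₂⁻¹e₃ ∈ ϖM^♯ ⊆ M` lies on the axis `𝔭^{2ρ+1+s}e₃`, so `|D₂|⁻¹ ≤ |ϖ|^{2ρ+s}`, and the Gram entry `G₀₁ = ϖ^ρ·D₂·(ζσy″ − σx·f)` with the FIXED `f = −(D₁ + D₂Nζ)∕D₂`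
is integral — which is (R) `|ζσy″ − σx·f| ≤ |ϖ|^{ρ+s}`. [cite: Jacobowitz1962, §7] [cite: Kottwitz1986BaseChangeUnits, §1 pp. 240–241] -/
theorem exists_fixed_of_isTypeTwoPolarisable_latt_hnf_glued {σ : K →+* K} (hσ : ∀ a, σ (σ a) = a) (hvσ : ∀ a, Valued.v (σ a) = Valued.v a)
    {ϖ : K} (hϖ0 : ϖ ≠ 0) (hϖ1 : Valued.v ϖ ≤ 1) (ρ s : ℕ) {x ζ y'' : K} (hx : Valued.v x ≤ 1) (hζ : Valued.v ζ ≤ 1) (hy'' : Valued.v y'' ≤ 1)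
    (V : GL (Fin 3) K) (hV : (V : Matrix (Fin 3) (Fin 3) K) = !![1, 0, 0; x, ϖ ^ ρ, 0; x * ζ + y'', ϖ ^ ρ * ζ, ϖ ^ (2 * ρ + 1 + s)])
    (hM : IsTypeTwoPolarisable σ ϖ (latt (V : Matrix (Fin 3) (Fin 3) K))) :
    ∃ f : K, σ f = f ∧ Valued.v (ζ * σ y'' - σ x * f) ≤ Valued.v ϖ ^ (ρ + s) := by
  obtain ⟨D, hD, hvert⟩ := hM
  set c : ℕ := 2 * ρ + 1 + s with hc
  have hvϖ : 0 < Valued.v ϖ := (Valuation.pos_iff _).2 hϖ0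
  have hpc : (ϖ ^ ρ : K) ≠ 0 := pow_ne_zero _ hϖ0
  have hrc : (ϖ ^ c : K) ≠ 0 := pow_ne_zero _ hϖ0
  have hD2 : D 2 ≠ 0 := (hD 2).2
  have hdetD : IsUnit (Matrix.diagonal D).det := by
    rw [Matrix.det_diagonal, Fin.prod_univ_three]
    exact (mul_ne_zero (mul_ne_zero (hD 0).2 (hD 1).2) hD2).isUnit
  -- the lattice is integral
  have hy : Valued.v (x * ζ + y'') ≤ 1 :=
    (Valuation.map_add _ _ _).trans (max_le (by rw [map_mul]; exact mul_le_one' hx hζ) hy'')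
  have hint : ∀ m ∈ latt (V : Matrix (Fin 3) (Fin 3) K), ∀ i, Valued.v (m i) ≤ 1 := by
    intro m hm i
    rw [hV] at hm
    have hle := latt_hnf_le_stdLattice (x := x) (y := x * ζ + y'') (z := ϖ ^ ρ * ζ) (p := ϖ ^ ρ) (r := ϖ ^ c) hx hy
      (by rw [map_mul, map_pow]; exact mul_le_one' (pow_le_one' hϖ1 _) hζ) (by rw [map_pow]; exact pow_le_one' hϖ1 _) (by rw [map_pow]; exact pow_le_one' hϖ1 _)
    exact (mem_stdLattice.1 (hle hm)) i
  -- `D₂⁻¹ e₃` lies in the dual lattice, so `ϖ·D₂⁻¹ e₃` lies in `ϖM^♯ ⊆ M`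
  have hw' : Pi.single (2 : Fin 3) (D 2)⁻¹ ∈ dualLatt σ (Matrix.diagonal D) (latt (V : Matrix (Fin 3) (Fin 3) K)) := by
    rw [mem_dualLatt]
    intro m hm
    rw [pairing_apply]
    have hsum : ∑ i : Fin 3, ∑ j : Fin 3, σ (m i) * Matrix.diagonal D i j * (Pi.single (2 : Fin 3) (D 2)⁻¹ : Fin 3 → K) j = σ (m 2) := by
      simp [Matrix.diagonal, Pi.single_apply, hD2]
    rw [hsum, hvσ]
    exact hint m hm 2
  have hw : Pi.single (2 : Fin 3) (ϖ * (D 2)⁻¹) ∈ latt (V : Matrix (Fin 3) (Fin 3) K) := by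
    refine scaleLattice_dualLatt_le_of_isVertexLattice hvσ hdetD hvert ((mem_scaleLattice_iff hϖ0 _ _).2 ?_)
    rwa [← smul_eq_mul, Pi.single_smul', smul_smul, inv_mul_cancel₀ hϖ0, one_smul]
  have hD2v : Valued.v (D 2)⁻¹ ≤ Valued.v ϖ ^ (2 * ρ + s) := by
    rw [hV] at hw
    have h := (single_two_mem_latt_hnf_iff x (x * ζ + y'') (ϖ ^ ρ * ζ) hpc hrc _).1 hw
    rw [map_mul, map_pow, hc, show 2 * ρ + 1 + s = (2 * ρ + s) + 1 by ring, pow_succ, mul_comm (Valued.v ϖ ^ (2 * ρ + s)) (Valued.v ϖ)] at h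
    exact le_of_mul_le_mul_left h hvϖ
  -- the Gram entry `G₀₁`
  have hG := ((isVertexLattice_latt_iff_of_v σ hvσ hϖ0 (Matrix.diagonal D) 2 V).1 hvert).1
  have h01 := hG 0 1
  rw [formCongr_hnf_diagonal σ D x (x * ζ + y'') (ϖ ^ ρ * ζ) (ϖ ^ ρ) (ϖ ^ c) V hV] at h01
  simp only [Matrix.of_apply, Matrix.cons_val', Matrix.cons_val_zero, Matrix.cons_val_one, Matrix.empty_val', Matrix.cons_val_fin_one] at h01
  -- rewrite `G₀₁ = ϖ^ρ · D₂ · (ζσy″ − σx·f)` with `f = −(D₁ + D₂ ζ σζ)∕D₂`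
  refine ⟨-(D 1 + D 2 * (ζ * σ ζ)) / D 2, ?_, ?_⟩
  · rw [map_div₀, map_neg, map_add, map_mul, map_mul, hσ, (hD 1).1, (hD 2).1, mul_comm (σ ζ) ζ]
  · have hrew : σ x * D 1 * ϖ ^ ρ + σ (x * ζ + y'') * D 2 * (ϖ ^ ρ * ζ) = ϖ ^ ρ * D 2 * (ζ * σ y'' - σ x * (-(D 1 + D 2 * (ζ * σ ζ)) / D 2)) := by
      rw [map_add, map_mul]; field_simp; ring
    rw [hrew, map_mul, map_mul, map_pow] at h01
    -- `|ϖ|^ρ |D₂| |…| ≤ 1` and `|D₂|⁻¹ ≤ |ϖ|^{2ρ+s}`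
    have hD2pos : 0 < Valued.v (D 2) := (Valuation.pos_iff _).2 hD2
    have hϖρpos : 0 < Valued.v ϖ ^ ρ := pow_pos hvϖ _
    rw [map_inv₀] at hD2v
    have key : Valued.v (ζ * σ y'' - σ x * (-(D 1 + D 2 * (ζ * σ ζ)) / D 2)) ≤ (Valued.v ϖ ^ ρ * Valued.v (D 2))⁻¹ := by
      rw [← one_mul (Valued.v ϖ ^ ρ * Valued.v (D 2))⁻¹, le_mul_inv_iff₀ (mul_pos hϖρpos hD2pos)]
      calc Valued.v (ζ * σ y'' - σ x * (-(D 1 + D 2 * (ζ * σ ζ)) / D 2)) * (Valued.v ϖ ^ ρ * Valued.v (D 2))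
          = Valued.v ϖ ^ ρ * Valued.v (D 2) * Valued.v (ζ * σ y'' - σ x * (-(D 1 + D 2 * (ζ * σ ζ)) / D 2)) := mul_comm _ _
        _ ≤ 1 := h01
    refine key.trans ?_
    rw [mul_inv]
    calc (Valued.v ϖ ^ ρ)⁻¹ * (Valued.v (D 2))⁻¹ ≤ (Valued.v ϖ ^ ρ)⁻¹ * Valued.v ϖ ^ (2 * ρ + s) := mul_le_mul_right hD2v _
      _ = Valued.v ϖ ^ (ρ + s) := by
          rw [show 2 * ρ + s = ρ + (ρ + s) by ring, pow_add, inv_mul_cancel_left₀ hϖρpos.ne']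

/-! ## §3  (R) ⟹ polarisable: the explicit form -/

/-- **(R) ⟹ TYPE-2 POLARISABLE, EXPLICIT FORM** (`ρ ≥ 1`, `s` even `≥ 2`): if `ζσ(y″) ≡ σ(x)·f (𝔭^{ρ+s})` for a FIXED `f`, then with `π₀ := ϖσϖ`, `P := π₀^{−(ρ+s∕2)}`, `Nζ := ζσζ`,
`B := ζσy″ − σx·f` and the fixed diagonal form `D = (−P·Bσ(B)∕f − NxD₁ − NyP, −P(Nζ + f), P)` the lattice `latt V` is a type-2 vertex lattice of `diag D`: the Gram matrix
`G = (σV)ᵀ diag D V` has `G₀₁ = ϖ^ρPB`, `G₁₀ = σ(ϖ^ρ)Pσ(B)`, `G₁₁ = −π₀^ρPf` (a unit), `G₀₀ = −PBσ(B)∕f` — so `G₀₀G₁₁ = G₀₁G₁₀` — all other entries in `𝔭`, and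
`|det G| = |ϖ|²` because `|D₀| = |ϖ|^{−2ρ}` (`|f·Nx| = |ϖ|^s` dominates, by the wild trace bound). [cite: Jacobowitz1962, §7] [cite: Kottwitz1986BaseChangeUnits, §1 pp. 240–241] -/
theorem isVertexLattice_two_latt_hnf_glued_explicit {σ : K →+* K} (hσ : ∀ a, σ (σ a) = a) (hvσ : ∀ a, Valued.v (σ a) = Valued.v a)
    {ϖ : K} (hϖ0 : ϖ ≠ 0) (hϖ1 : Valued.v ϖ < 1) (hTr : ∀ a : K, Valued.v (a + σ a) ≤ Valued.v ϖ * Valued.v a)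
    (ρ s : ℕ) (hρ : 1 ≤ ρ) (hs2 : 2 ∣ s) (hs : 1 ≤ s) {x ζ y'' : K} (hx : Valued.v x = 1) (hζ : Valued.v ζ = 1) (hy'' : Valued.v y'' = Valued.v ϖ ^ s)
    (V : GL (Fin 3) K) (hV : (V : Matrix (Fin 3) (Fin 3) K) = !![1, 0, 0; x, ϖ ^ ρ, 0; x * ζ + y'', ϖ ^ ρ * ζ, ϖ ^ (2 * ρ + 1 + s)])
    {f : K} (hf : σ f = f) (hR : Valued.v (ζ * σ y'' - σ x * f) ≤ Valued.v ϖ ^ (ρ + s)) {P D₁ D₀ : K} (hP : P = ((ϖ * σ ϖ) ^ (ρ + s / 2))⁻¹)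
    (hD₁ : D₁ = -(P * (ζ * σ ζ + f)))
    (hD₀ : D₀ = -(P * ((ζ * σ y'' - σ x * f) * (σ ζ * y'' - x * f)) / f) - (σ x * D₁ * x + σ (x * ζ + y'') * P * (x * ζ + y''))) :
    (∀ i, σ ((![D₀, D₁, P] : Fin 3 → K) i) = (![D₀, D₁, P] : Fin 3 → K) i ∧ (![D₀, D₁, P] : Fin 3 → K) i ≠ 0) ∧
      IsVertexLattice σ ϖ (Matrix.diagonal ![D₀, D₁, P]) 2 (latt (V : Matrix (Fin 3) (Fin 3) K)) := by
  obtain ⟨t, rfl⟩ := hs2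
  have ht : 1 ≤ t := by omega
  rw [show ρ + 2 * t / 2 = ρ + t by omega] at hP
  set c : ℕ := 2 * ρ + 1 + 2 * t with hc
  have hvϖ : 0 < Valued.v ϖ := (Valuation.pos_iff _).2 hϖ0
  have hϖ1' : Valued.v ϖ ≤ 1 := hϖ1.le
  have hpowlt : ∀ {m n : ℕ}, m < n → Valued.v ϖ ^ n < Valued.v ϖ ^ m := fun h => pow_lt_pow_right_of_lt_one₀ hvϖ hϖ1 h
  have hpowle : ∀ n : ℕ, Valued.v ϖ ^ n ≤ 1 := fun n => pow_le_one₀ zero_le hϖ1'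
  -- `|f| = |ϖ|^{2t}`
  have h1 : Valued.v (ζ * σ y'') = Valued.v ϖ ^ (2 * t) := by rw [map_mul, hζ, hvσ, hy'', one_mul]
  have hlt : Valued.v (ζ * σ y'' - σ x * f) < Valued.v (ζ * σ y'') := hR.trans_lt (by rw [h1]; exact hpowlt (by omega))
  have hvxf : Valued.v (σ x * f) = Valued.v (ζ * σ y'') := by
    have e : σ x * f = ζ * σ y'' + -(ζ * σ y'' - σ x * f) := by ring
    rw [e]
    exact Valuation.map_add_eq_of_lt_left _ (by rwa [Valuation.map_neg])
  have hvf : Valued.v f = Valued.v ϖ ^ (2 * t) := by rw [map_mul, hvσ, hx, one_mul] at hvxf; exact hvxf.trans h1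
  have hfv : Valued.v f < 1 := by rw [hvf]; exact pow_lt_one₀ zero_le hϖ1 (by omega)
  have hf0 : f ≠ 0 := fun h => by rw [h, map_zero] at hvf; exact pow_ne_zero _ hvϖ.ne' hvf.symm
  -- `σB` and its valuation
  have hσB : σ (ζ * σ y'' - σ x * f) = σ ζ * y'' - x * f := by rw [map_sub, map_mul, map_mul, hσ, hσ, hf]
  have hσS : σ (σ ζ * y'' - x * f) = ζ * σ y'' - σ x * f := by rw [map_sub, map_mul, map_mul, hσ, hf]
  have hvS : Valued.v (σ ζ * y'' - x * f) = Valued.v (ζ * σ y'' - σ x * f) := by rw [← hσB, hvσ]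
  -- the unit `Nζ + f`
  set Nζ : K := ζ * σ ζ with hNζ
  have hvNζ : Valued.v Nζ = 1 := by rw [hNζ, map_mul, hvσ, hζ, one_mul]
  have hσNζ : σ Nζ = Nζ := by rw [hNζ, map_mul, hσ, mul_comm]
  have hvNf : Valued.v (Nζ + f) = 1 := by rw [v_add_eq_of_lt (by rw [hvNζ]; exact hfv), hvNζ]
  -- the uniformiser of `F` and `P = π₀^{−(ρ+t)}`
  set π₀ : K := ϖ * σ ϖ with hπ₀
  have hσπ₀ : σ π₀ = π₀ := by rw [hπ₀, map_mul, hσ, mul_comm]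
  have hvπ₀ : Valued.v π₀ = Valued.v ϖ ^ 2 := by rw [hπ₀, map_mul, hvσ, sq]
  have hσϖ0 : σ ϖ ≠ 0 := fun h => hϖ0 (by rw [← hσ ϖ, h, map_zero])
  have hπ₀0 : π₀ ≠ 0 := mul_ne_zero hϖ0 hσϖ0
  set E2 : ℤᵐ⁰ := Valued.v ϖ ^ (2 * ρ + 2 * t) with hE2
  have hE20 : E2 ≠ 0 := pow_ne_zero _ hvϖ.ne'
  have hvP : Valued.v P = E2⁻¹ := by rw [hP, map_inv₀, map_pow, hvπ₀, ← pow_mul, hE2]; congr 2; ring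
  have hP0 : P ≠ 0 := by rw [hP]; exact inv_ne_zero (pow_ne_zero _ hπ₀0)
  have hσP : σ P = P := by rw [hP, map_inv₀, map_pow, hσπ₀]
  have hvϖc : Valued.v (ϖ ^ c) = E2 * Valued.v ϖ := by rw [map_pow, hc, show 2 * ρ + 1 + 2 * t = (2 * ρ + 2 * t) + 1 by ring, pow_succ]
  have hPc : E2⁻¹ * (E2 * Valued.v ϖ) = Valued.v ϖ := by rw [← mul_assoc, inv_mul_cancel₀ hE20, one_mul]
  -- the data of the form
  set y : K := x * ζ + y'' with hy
  have hvD₁ : Valued.v D₁ = E2⁻¹ := by rw [hD₁, Valuation.map_neg, map_mul, hvP, hvNf, mul_one]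
  have hD₁0 : D₁ ≠ 0 := fun h => by rw [h, map_zero] at hvD₁; exact (inv_ne_zero hE20) hvD₁.symm
  have hσD₁ : σ D₁ = D₁ := by rw [hD₁, map_neg, map_mul, map_add, hσP, hσNζ, hf]
  have hσD₀ : σ D₀ = D₀ := by
    rw [hD₀]
    simp only [map_neg, map_sub, map_add, map_mul, map_div₀, hσ, hσP, hσD₁, hf, hy]
    ring
  -- valuations of the data
  have hvy : Valued.v y ≤ 1 := by
    rw [hy]; refine (Valuation.map_add _ _ _).trans (max_le ?_ ?_)
    · rw [map_mul, hx, hζ, one_mul]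
    · rw [hy'']; exact hpowle _
  have hvNx : Valued.v (σ x * x) = 1 := by rw [map_mul, hvσ, hx, one_mul]
  -- `|D₀| = |ϖ|^{−2ρ}`: `D₀ = P·(f·Nx + rest)` with `|rest| < |f·Nx| = |ϖ|^{2t}`
  have hD₀eq : D₀ = P * (f * (σ x * x) + (-((ζ * σ y'' - σ x * f) * (σ ζ * y'' - x * f) / f) - (σ (x * ζ) * y'' + σ (σ (x * ζ) * y'')) - σ y'' * y'')) := by
    rw [hD₀, hD₁, hy, hNζ]
    simp only [map_add, map_mul, hσ]
    field_simp
    ring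
  have hvmain : Valued.v (f * (σ x * x)) = Valued.v ϖ ^ (2 * t) := by rw [map_mul, hvf, hvNx, mul_one]
  have hvrest : Valued.v (-((ζ * σ y'' - σ x * f) * (σ ζ * y'' - x * f) / f) - (σ (x * ζ) * y'' + σ (σ (x * ζ) * y'')) - σ y'' * y'') < Valued.v ϖ ^ (2 * t) := by
    refine (Valuation.map_sub _ _ _).trans_lt (max_lt ((Valuation.map_sub _ _ _).trans_lt (max_lt ?_ ?_)) ?_)
    · rw [Valuation.map_neg, map_div₀, map_mul, hvS, hvf]
      have hBB : Valued.v (ζ * σ y'' - σ x * f) * Valued.v (ζ * σ y'' - σ x * f) ≤ Valued.v ϖ ^ (2 * ρ + 2 * t) * Valued.v ϖ ^ (2 * t) :=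
        (mul_le_mul' hR hR).trans_eq (by rw [← pow_add, ← pow_add]; congr 1; ring)
      calc Valued.v (ζ * σ y'' - σ x * f) * Valued.v (ζ * σ y'' - σ x * f) / Valued.v ϖ ^ (2 * t)
          ≤ Valued.v ϖ ^ (2 * ρ + 2 * t) * Valued.v ϖ ^ (2 * t) / Valued.v ϖ ^ (2 * t) := by
            rw [div_eq_mul_inv, div_eq_mul_inv]; exact mul_le_mul_left hBB _
        _ = Valued.v ϖ ^ (2 * ρ + 2 * t) := by rw [mul_div_assoc, div_self (pow_ne_zero _ hvϖ.ne'), mul_one]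
        _ < Valued.v ϖ ^ (2 * t) := hpowlt (by omega)
    · refine (hTr _).trans_lt ?_
      rw [map_mul, hvσ, map_mul, hx, hζ, one_mul, one_mul, hy'']
      calc Valued.v ϖ * Valued.v ϖ ^ (2 * t) < 1 * Valued.v ϖ ^ (2 * t) := mul_lt_mul_of_pos_right hϖ1 (pow_pos hvϖ _)
        _ = Valued.v ϖ ^ (2 * t) := one_mul _
    · rw [map_mul, hvσ, hy'', ← pow_add]
      exact hpowlt (by omega)
  have hvD₀ : Valued.v D₀ = (Valued.v ϖ ^ (2 * ρ))⁻¹ := by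
    rw [hD₀eq, map_mul, hvP, v_add_eq_of_lt (by rw [hvmain]; exact hvrest), hvmain, hE2, pow_add, mul_inv, mul_assoc,
      inv_mul_cancel₀ (pow_ne_zero _ hvϖ.ne'), mul_one]
  have hD₀0 : D₀ ≠ 0 := fun h => by
    rw [h, map_zero] at hvD₀; exact (inv_ne_zero (pow_ne_zero _ hvϖ.ne')) hvD₀.symm
  -- the diagonal form
  set D : Fin 3 → K := ![D₀, D₁, P] with hDdef
  have hD0 : D 0 = D₀ := rfl; have hD1 : D 1 = D₁ := rfl; have hD2 : D 2 = P := rfl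
  refine ⟨fun i => ?_, ?_⟩
  · fin_cases i; exacts [⟨hσD₀, hD₀0⟩, ⟨hσD₁, hD₁0⟩, ⟨hσP, hP0⟩]
  -- the Gram matrix, entry by entry
  have hG := formCongr_hnf_diagonal σ D x y (ϖ ^ ρ * ζ) (ϖ ^ ρ) (ϖ ^ c) V (by rw [hV])
  rw [hD0, hD1, hD2] at hG
  have e00 : D₀ + σ x * D₁ * x + σ y * P * y = -(P * ((ζ * σ y'' - σ x * f) * (σ ζ * y'' - x * f)) / f) := by rw [hD₀]; ring
  have e01 : σ x * D₁ * ϖ ^ ρ + σ y * P * (ϖ ^ ρ * ζ) = ϖ ^ ρ * (P * (ζ * σ y'' - σ x * f)) := by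
    rw [hD₁, hy, hNζ, map_add, map_mul]; ring
  have e10 : σ (ϖ ^ ρ) * D₁ * x + σ (ϖ ^ ρ * ζ) * P * y = σ (ϖ ^ ρ) * (P * (σ ζ * y'' - x * f)) := by
    rw [hD₁, hy, hNζ, map_mul]; ring
  have e11 : σ (ϖ ^ ρ) * D₁ * ϖ ^ ρ + σ (ϖ ^ ρ * ζ) * P * (ϖ ^ ρ * ζ) = -(π₀ ^ ρ * P * f) := by
    rw [hD₁, hNζ, hπ₀, map_mul, map_pow, mul_pow]; ring
  have hvϖρ : Valued.v (ϖ ^ ρ) = Valued.v ϖ ^ ρ := map_pow _ _ _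
  have hvσϖρ : Valued.v (σ (ϖ ^ ρ)) = Valued.v ϖ ^ ρ := by rw [hvσ, map_pow]
  have hvσϖc : Valued.v (σ (ϖ ^ c)) = E2 * Valued.v ϖ := by rw [hvσ, hvϖc]
  have hE2split : E2 = Valued.v ϖ ^ ρ * Valued.v ϖ ^ (ρ + 2 * t) := by rw [hE2, ← pow_add]; congr 1; ring
  -- the four bounds of the upper-left block
  have h00 : Valued.v (D₀ + σ x * D₁ * x + σ y * P * y) ≤ 1 := by
    rw [e00, Valuation.map_neg, map_div₀, map_mul, map_mul, hvP, hvS, hvf]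
    have hBB : Valued.v (ζ * σ y'' - σ x * f) * Valued.v (ζ * σ y'' - σ x * f) ≤ E2 * Valued.v ϖ ^ (2 * t) :=
      (mul_le_mul' hR hR).trans_eq (by rw [hE2, ← pow_add, ← pow_add]; congr 1; ring)
    calc E2⁻¹ * (Valued.v (ζ * σ y'' - σ x * f) * Valued.v (ζ * σ y'' - σ x * f)) / Valued.v ϖ ^ (2 * t)
        ≤ E2⁻¹ * (E2 * Valued.v ϖ ^ (2 * t)) / Valued.v ϖ ^ (2 * t) := by
          rw [div_eq_mul_inv, div_eq_mul_inv]; exact mul_le_mul_left (mul_le_mul_right hBB _) _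
      _ = 1 := by rw [← mul_assoc, inv_mul_cancel₀ hE20, one_mul, div_self (pow_ne_zero _ hvϖ.ne')]
  have hPB : Valued.v ϖ ^ ρ * (E2⁻¹ * Valued.v (ζ * σ y'' - σ x * f)) ≤ 1 :=
    calc Valued.v ϖ ^ ρ * (E2⁻¹ * Valued.v (ζ * σ y'' - σ x * f)) ≤ Valued.v ϖ ^ ρ * (E2⁻¹ * Valued.v ϖ ^ (ρ + 2 * t)) :=
          mul_le_mul_right (mul_le_mul_right hR _) _
      _ = (Valued.v ϖ ^ ρ * (Valued.v ϖ ^ ρ)⁻¹) * ((Valued.v ϖ ^ (ρ + 2 * t))⁻¹ * Valued.v ϖ ^ (ρ + 2 * t)) := by rw [hE2split, mul_inv]; ac_rfl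
      _ = 1 := by rw [mul_inv_cancel₀ (pow_ne_zero _ hvϖ.ne'), inv_mul_cancel₀ (pow_ne_zero _ hvϖ.ne'), one_mul]
  have h01 : Valued.v (σ x * D₁ * ϖ ^ ρ + σ y * P * (ϖ ^ ρ * ζ)) ≤ 1 := by
    rw [e01, map_mul, map_mul, hvϖρ, hvP]; exact hPB
  have h10 : Valued.v (σ (ϖ ^ ρ) * D₁ * x + σ (ϖ ^ ρ * ζ) * P * y) ≤ 1 := by
    rw [e10, map_mul, map_mul, hvσϖρ, hvP, hvS]; exact hPB
  have h11 : Valued.v (σ (ϖ ^ ρ) * D₁ * ϖ ^ ρ + σ (ϖ ^ ρ * ζ) * P * (ϖ ^ ρ * ζ)) ≤ 1 := by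
    rw [e11, Valuation.map_neg, map_mul, map_mul, map_pow, hvπ₀, hvP, hvf, ← pow_mul, hE2, pow_add, mul_inv,
      show Valued.v ϖ ^ (2 * ρ) * ((Valued.v ϖ ^ (2 * ρ))⁻¹ * (Valued.v ϖ ^ (2 * t))⁻¹) * Valued.v ϖ ^ (2 * t) =
        (Valued.v ϖ ^ (2 * ρ) * (Valued.v ϖ ^ (2 * ρ))⁻¹) * ((Valued.v ϖ ^ (2 * t))⁻¹ * Valued.v ϖ ^ (2 * t)) by ac_rfl,
      mul_inv_cancel₀ (pow_ne_zero _ hvϖ.ne'), inv_mul_cancel₀ (pow_ne_zero _ hvϖ.ne'), one_mul]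
  -- the five entries in `𝔭`
  have h02 : Valued.v (σ y * P * ϖ ^ c) ≤ Valued.v ϖ := by
    rw [map_mul, map_mul, hvσ, hvP, hvϖc, mul_assoc, hPc]; exact mul_le_of_le_one_left' hvy
  have h12 : Valued.v (σ (ϖ ^ ρ * ζ) * P * ϖ ^ c) ≤ Valued.v ϖ := by
    rw [map_mul, map_mul, hvσ, map_mul, hvϖρ, hζ, mul_one, hvP, hvϖc, mul_assoc, hPc]; exact mul_le_of_le_one_left' (hpowle ρ)
  have h20 : Valued.v (σ (ϖ ^ c) * P * y) ≤ Valued.v ϖ := by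
    rw [map_mul, map_mul, hvσϖc, hvP, mul_comm (E2 * Valued.v ϖ) E2⁻¹, hPc]; exact mul_le_of_le_one_right' hvy
  have h21 : Valued.v (σ (ϖ ^ c) * P * (ϖ ^ ρ * ζ)) ≤ Valued.v ϖ := by
    rw [map_mul, map_mul, hvσϖc, hvP, mul_comm (E2 * Valued.v ϖ) E2⁻¹, hPc, map_mul, hvϖρ, hζ, mul_one]
    exact mul_le_of_le_one_right' (hpowle ρ)
  have h22 : Valued.v (σ (ϖ ^ c) * P * ϖ ^ c) ≤ Valued.v ϖ := by
    rw [map_mul, map_mul, hvσϖc, hvP, mul_comm (E2 * Valued.v ϖ) E2⁻¹, hPc, map_pow]; exact mul_le_of_le_one_right' (hpowle c)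
  -- the rank-one identity `G₀₀G₁₁ = G₀₁G₁₀`
  have hrk : (D₀ + σ x * D₁ * x + σ y * P * y) * (σ (ϖ ^ ρ) * D₁ * ϖ ^ ρ + σ (ϖ ^ ρ * ζ) * P * (ϖ ^ ρ * ζ)) =
      (σ x * D₁ * ϖ ^ ρ + σ y * P * (ϖ ^ ρ * ζ)) * (σ (ϖ ^ ρ) * D₁ * x + σ (ϖ ^ ρ * ζ) * P * y) := by
    rw [e00, e01, e10, e11, hπ₀, map_pow, mul_pow]
    field_simp
  -- integrality of `G`
  have hGint : IsIntMatrix (formCongr σ V (Matrix.diagonal D)) := by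
    rw [hG]
    exact isIntMatrix_of_fin_three h00 h01 (h02.trans hϖ1') h10 h11 (h12.trans hϖ1') (h20.trans hϖ1') (h21.trans hϖ1') (h22.trans hϖ1')
  -- the determinant `|det G| = |ϖ|²`
  have hdet : Valued.v (formCongr σ V (Matrix.diagonal D)).det = Valued.v ϖ ^ 2 := by
    rw [det_formCongr_diagonal, det_coe_hnf x y (ϖ ^ ρ * ζ) (ϖ ^ ρ) (ϖ ^ c) V (by rw [hV]), hD0, hD1, hD2]
    simp only [map_mul, hvσ, hvD₀, hvD₁, hvP, hvϖρ, hvϖc]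
    set A := Valued.v ϖ ^ ρ with hA
    have hA0 : A ≠ 0 := pow_ne_zero _ hvϖ.ne'
    have e2 : Valued.v ϖ ^ (2 * ρ) = A * A := by rw [hA, ← pow_add]; congr 1; ring
    rw [e2]
    calc A * (E2 * Valued.v ϖ) * ((A * A)⁻¹ * E2⁻¹ * E2⁻¹) * (A * (E2 * Valued.v ϖ))
        = (A * A * (A * A)⁻¹) * (E2 * E2⁻¹) * (E2 * E2⁻¹) * (Valued.v ϖ * Valued.v ϖ) := by ac_rfl
      _ = Valued.v ϖ ^ 2 := by rw [mul_inv_cancel₀ (mul_ne_zero hA0 hA0), mul_inv_cancel₀ hE20, one_mul, one_mul, one_mul, sq]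
  have hdet' := hdet
  rw [hG] at hdet'
  have hinv : IsIntMatrix (ϖ • (formCongr σ V (Matrix.diagonal D))⁻¹) := by
    rw [hG]
    exact isIntMatrix_smul_inv_fin_three hϖ0 hϖ1' hdet' h00 h01 h10 h11 h02 h12 h20 h21 h22 hrk
  exact (isVertexLattice_latt_iff_of_v σ hvσ hϖ0 (Matrix.diagonal D) 2 V).2 ⟨hGint, hinv, hdet⟩

/-- **(R) ⟹ TYPE-2 POLARISABLE** (`ρ ≥ 1`, `s` even `≥ 2`), from the explicit form. [cite: Jacobowitz1962, §7] [cite: Kottwitz1986BaseChangeUnits, §1 pp. 240–241] -/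
theorem isTypeTwoPolarisable_latt_hnf_glued_of {σ : K →+* K} (hσ : ∀ a, σ (σ a) = a) (hvσ : ∀ a, Valued.v (σ a) = Valued.v a)
    {ϖ : K} (hϖ0 : ϖ ≠ 0) (hϖ1 : Valued.v ϖ < 1) (hTr : ∀ a : K, Valued.v (a + σ a) ≤ Valued.v ϖ * Valued.v a)
    (ρ s : ℕ) (hρ : 1 ≤ ρ) (hs2 : 2 ∣ s) (hs : 1 ≤ s) {x ζ y'' : K} (hx : Valued.v x = 1) (hζ : Valued.v ζ = 1) (hy'' : Valued.v y'' = Valued.v ϖ ^ s)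
    (V : GL (Fin 3) K) (hV : (V : Matrix (Fin 3) (Fin 3) K) = !![1, 0, 0; x, ϖ ^ ρ, 0; x * ζ + y'', ϖ ^ ρ * ζ, ϖ ^ (2 * ρ + 1 + s)])
    {f : K} (hf : σ f = f) (hR : Valued.v (ζ * σ y'' - σ x * f) ≤ Valued.v ϖ ^ (ρ + s)) :
    IsTypeTwoPolarisable σ ϖ (latt (V : Matrix (Fin 3) (Fin 3) K)) :=
  ⟨_, isVertexLattice_two_latt_hnf_glued_explicit hσ hvσ hϖ0 hϖ1 hTr ρ s hρ hs2 hs hx hζ hy'' V hV hf hR rfl rfl rfl⟩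

/-! ## §4  The criterion -/

/-- **THE TYPE-2 CRITERION (R) FOR THE GLUED STRATA** (MEMO v2.1 §T2.3, SPEC B5₂ (i)): `latt (1 0 0; x ϖ^ρ 0; xζ+y″ ϖ^ρζ ϖ^{2ρ+1+s})` with units `x, ζ`,
`|y″| = |ϖ|^s`, `ρ ≥ 1`, `s` even `≥ 2`, is a type-2 vertex lattice for some `σ`-fixed non-degenerate diagonal form iff `ζσ(y″)∕σ(x)` is `σ`-fixed modulo `𝔭^{ρ+s}` — the same
letters as the type-0 criterion ★ `isDualisableLattice_latt_hnf_glued_iff` at `2t = s`. [cite: Jacobowitz1962, §7] [cite: Kottwitz1986BaseChangeUnits, §1 pp. 240–241] -/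
theorem isTypeTwoPolarisable_latt_hnf_glued_iff {σ : K →+* K} (hσ : ∀ a, σ (σ a) = a) (hvσ : ∀ a, Valued.v (σ a) = Valued.v a)
    {ϖ : K} (hϖ0 : ϖ ≠ 0) (hϖ1 : Valued.v ϖ < 1) (hTr : ∀ a : K, Valued.v (a + σ a) ≤ Valued.v ϖ * Valued.v a)
    (ρ s : ℕ) (hρ : 1 ≤ ρ) (hs2 : 2 ∣ s) (hs : 1 ≤ s) {x ζ y'' : K} (hx : Valued.v x = 1) (hζ : Valued.v ζ = 1) (hy'' : Valued.v y'' = Valued.v ϖ ^ s)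
    (V : GL (Fin 3) K) (hV : (V : Matrix (Fin 3) (Fin 3) K) = !![1, 0, 0; x, ϖ ^ ρ, 0; x * ζ + y'', ϖ ^ ρ * ζ, ϖ ^ (2 * ρ + 1 + s)]) :
    IsTypeTwoPolarisable σ ϖ (latt (V : Matrix (Fin 3) (Fin 3) K)) ↔ ∃ f : K, σ f = f ∧ Valued.v (ζ * σ y'' - σ x * f) ≤ Valued.v ϖ ^ (ρ + s) :=
  ⟨exists_fixed_of_isTypeTwoPolarisable_latt_hnf_glued hσ hvσ hϖ0 hϖ1.le ρ s hx.le hζ.le (by rw [hy'']; exact pow_le_one₀ zero_le hϖ1.le) V hV,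
    fun ⟨_, hf, hR⟩ => isTypeTwoPolarisable_latt_hnf_glued_of hσ hvσ hϖ0 hϖ1 hTr ρ s hρ hs2 hs hx hζ hy'' V hV hf hR⟩

end Summit.HodgeConjecture.HodgeConjecture.Cruxes.H413.F0P3cDyRamDiagonalGluedTubeCriterionTypeTwo

end
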